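import Literature.MathematicalPhysics.QuantumFieldTheory.BalabanImbrieJaffe1984to88.BIJ85UnitPropagator433
import Literature.MathematicalPhysics.QuantumFieldTheory.BalabanImbrieJaffe1984to88.BIJ85NoZeroModes309Torus
import Literature.MathematicalPhysics.QuantumFieldTheory.Balaban1983to89.B6Eq232GaussianMoment

/-!
# `BalabanImbrieJaffe1984to88.BIJ85SecondMoment411` — T. Bałaban, J. Imbrie, A. Jaffe, *Renormalization of the Higgs model:
minimizers, propagators and the stability of mean field theory*, Commun. Math. Phys. **97** (1985) 299–329
[BalabanImbrieJaffe1985]: Sect. 4.1 p. 309 — *"The propagator G_{k,Ax} itself is the second moment of the measure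
exp(−½‖∂A‖²), restricted to the space of gauge fields which satisfy the kth axial gauge condition and condition on the
kth average fields vanishing."* — PROVED: the matrix elements `⟨J, G_{k,Ax}J′⟩` of the propagator defined by (4.1.1) ARE the
second moments `Z_{k,Ax}^{−1}∫δ(Q_kA)δ_{k,Ax}(A)⟨A,J⟩⟨A,J′⟩exp(−½‖∂A‖²)𝒟A`, abstractly and on the tori of the series; the same
for the unit-lattice propagator `C^{(k)}` of (4.3.3)

statement-level skeleton of published theorems with citation tags; proofs where landed; nothing here is a claim about the Yang–Mills mass gap

PDF held: `paper:balaban1985-cmp97-bij-higgs-minimizers` (journal page = PDF page + 298); p. 309–311 [PDF 11–13] read on the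
renders `run/shared/lean/pub/pub-balaban/t4/b2b-balaban-t4-lit2/renders/bij1985/1985-cmp97-bij-higgs-minimizers-p012-x2.png`,
`…-p013-x2.png` and the text layer `p0011.txt`.

CITATION HEADER (lean-in-tree rule).  Part of the lit-balaban TYPED SKELETON (HOME `run/shared/lean/pub/lit-balaban/`).
WHAT IS REPRODUCED = the p. 309 "second moment" sentence of SKELETON row **C1.Eq4.1.1-4.1.2** (owner r15; the row's files
of record `BIJ85AxialPropagator411` (p09) prove that the operator formula `G_{k,Ax} = ι_V(ι_V^*∂^*∂ι_V)⁻¹ι_V^*` SATISFIES the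
generating-function identity (4.1.1); the literal second-moment identity was in no file), and the same reading of (4.3.3)
(row **C1.Eq4.3.1-4.3.3**, `BIJ85UnitPropagator433`, p09 g2).  Phase-2 proof seat p33 gen 3 (unit `lit-balaban-p33`; this
gen's first file `BIJ85SigmaGaugeInvariance` p250242); TAKING line HOME/STATUS.md 2026-08-21T05:30:42Z; referee ref-5.

THE PRINTED TEXT (verbatim, p. 309 [PDF 11]).  *"We require an axial gauge propagator to express the effective action. Define
G_{k,Ax} by the functional integral exp(½⟨J, G_{k,Ax}J⟩) = Z_{k,Ax}^{−1}∫𝒟Aδ(Q_kA)δ_{k,Ax}(A)exp(−½‖∂A‖² + ⟨A, J⟩). (4.1.1) Here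
the normalization factor Z_{k,Ax} can be computed by setting J = 0. … The propagator G_{k,Ax} itself is the second moment of the
measure exp(−½‖∂A‖²), restricted to the space of gauge fields which satisfy the kth axial gauge condition and condition on
the kth average fields vanishing. We do not know a simple operator theoretic definition of G_{k,Ax}, and we generally establish
the properties of the propagator by appealing to the definition (4.1.1)."*  p. 311 [PDF 13]: *"The action Δ_k yields the unit
lattice propagator C^{(k)}, defined as follows: exp(½⟨J, C^{(k)}J⟩) = (Z^{(k)})^{−1}∫𝒟Bδ(QB)δ_{Ax}(B)exp(−½⟨B, Δ_kB⟩ + ⟨B, J⟩).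
(4.3.3)"*.

WHAT IS PROVED HERE (0 `sorry`, standard axioms, theorems only; kind «knitting / model instance»).
§1 GAUSSIAN SECOND MOMENT in p09's abstract setting (`W` a finite-dimensional real inner product space with its volume, `S : W → F`
linear without zero modes, `formOp S = S^*S`, `formInv S = (S^*S)⁻¹`): `integral_inner_mul_inner_mul_exp` —
`∫_W ⟨w,a⟩⟨w,b⟩e^{−½‖Sw‖²}dw = ⟨a,(S^*S)⁻¹b⟩·∫_W e^{−½‖Sw‖²}dw` (p22 g4's `B6Eq232GaussianMoment.integral_gauss_bilinear`, the
t-derivative of the sourced first moment under the integral sign, at `M = S^*S`).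
§2 **(4.1.1) ⇒ THE SECOND MOMENT** (`E` ⊇ the constraint subspace `V` = support of `δ(Q_kA)δ_{k,Ax}(A)`, `D = ∂`, no zero modes of
`∂` on `V`): `inner_axialPropagator_eq_secondMoment` — `⟨J, G_{k,Ax}J′⟩ = Z_{k,Ax}^{−1}∫_V ⟨A,J⟩⟨A,J′⟩e^{−½‖∂A‖²}dA` for the operator
formula `axialPropagator V D`; `secondMoment_of_isAxialPropagator` — for ANY operator `G` satisfying the printed definition (4.1.1)
(p09's `IsAxialPropagator V D G`), its symmetric part `½(⟨J, GJ′⟩ + ⟨J′, GJ⟩)` is that second moment ((4.1.1) sees only the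
quadratic form); `inner_self_axialPropagator_eq` (J = J′: `⟨J, G_{k,Ax}J⟩ = Z^{−1}∫⟨A,J⟩²e^{−½‖∂A‖²} ≥ 0`).
§3 **(4.3.3) ⇒ `C^{(k)}` IS THE SECOND MOMENT of `exp(−½⟨B, Δ_kB⟩)` on `δ(QB)δ_{Ax}(B)`**: `inner_unitPropagator_eq_secondMoment` for p09 g2's
`unitPropagator` / `unitZ` / `deltaOp` (no zero modes of `∂H_{k,Ax}` on the unit-lattice constraint subspace `W`).
§4 ON THE TORI of the series (`LatticeFieldCalculus`; p09's `BondSpace`/`V411 P k`/`curlOp w c`/`torusPropagator w c k`, pairing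
`⟨A,J⟩ = Σ_b η^dA_bJ_b = bondPairing w`, `½‖∂A‖² = curlAction w c A`): `bondPairing_torusPropagator_eq_secondMoment` —
`⟨J, G_{k,Ax}J′⟩ = Z_{k,Ax}^{−1}∫_{Q_kA = 0, δ_{k,Ax}(A)} ⟨A,J⟩⟨A,J′⟩e^{−½‖∂A‖²}dA` UNCONDITIONALLY in the standing range `k ≤ m + K`
(`w > 0`, `c ≠ 0`; the no-zero-modes claim of p. 309 is this seat's gen-2 theorem `BIJ85NoZeroModes309Torus.noZeroModes_V411_holds`).
HONEST SCOPE.  "Second moment" = the matrix elements of the covariance of the normalized Gaussian measure on the constraint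
subspace (volume of the subspace as in p09's (4.1.1)); the measure is not packaged as a Mathlib `Measure`-valued object with a
covariance operator; nothing on the decay/regularity of G_{k,Ax} (Sects. 4.4, 7.2).  No new `def`; nothing is asserted beyond
the kernel-checked statements below.
-/

namespace Literature.MathematicalPhysics.QuantumFieldTheory.BalabanImbrieJaffe1984to88.BIJ85SecondMoment411

open MeasureTheory
open scoped RealInnerProductSpace
open BIJ85AxialPropagator411 BIJ85AxialMinimizer413 BIJ85UnitPropagator433

noncomputable section

/-! ## §1  The Gaussian second moment `∫⟨w,a⟩⟨w,b⟩e^{−½‖Sw‖²}dw = ⟨a,(S^*S)⁻¹b⟩·Z` -/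

section Gaussian

variable {W F : Type*} [NormedAddCommGroup W] [InnerProductSpace ℝ W] [FiniteDimensional ℝ W]
  [NormedAddCommGroup F] [InnerProductSpace ℝ F] [FiniteDimensional ℝ F]

/-- `⟨v, S^*S w⟩ = ⟨Sv, Sw⟩`. [folklore] -/
private theorem inner_formOp' (S : W →ₗ[ℝ] F) (v w : W) : ⟪v, formOp S w⟫ = ⟪S v, S w⟫ := by
  unfold formOp
  rw [LinearMap.comp_apply, LinearMap.adjoint_inner_right]

/-- `⟨w, S^*S w⟩ = ‖Sw‖²`. [folklore] -/
private theorem inner_formOp_self' (S : W →ₗ[ℝ] F) (w : W) : ⟪w, formOp S w⟫ = ‖S w‖ ^ 2 := by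
  rw [inner_formOp', real_inner_self_eq_norm_sq]

/-- `S^*S` is symmetric. [folklore] -/
private theorem formOp_symm' (S : W →ₗ[ℝ] F) (x y : W) : ⟪formOp S x, y⟫ = ⟪x, formOp S y⟫ := by
  rw [real_inner_comm, inner_formOp', inner_formOp', real_inner_comm]

/-- `(S^*S)(S^*S)⁻¹ = I` as a composition (no zero modes). [folklore] -/
private theorem formOp_comp_formInv {S : W →ₗ[ℝ] F} (hS : Function.Injective S) :
    formOp S ∘ₗ formInv S = LinearMap.id :=
  LinearMap.ext fun w => formOp_formInv hS w

/-- `(S^*S)⁻¹` is symmetric (no zero modes). [folklore] -/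
private theorem formInv_symm' {S : W →ₗ[ℝ] F} (hS : Function.Injective S) (x y : W) :
    ⟪formInv S x, y⟫ = ⟪x, formInv S y⟫ := by
  conv_lhs => rw [← formOp_formInv hS y]
  conv_rhs => rw [← formOp_formInv hS x]
  rw [← formOp_symm', formOp_symm' S (formInv S x)]

variable [MeasurableSpace W] [BorelSpace W]

/-- **The Gaussian second moment** (the content of *"the propagator … is the second moment of the measure exp(−½‖∂A‖²)"*): for
`S` without zero modes and the volume `dw` of `W`, `∫_W ⟨w,a⟩⟨w,b⟩e^{−½‖Sw‖²}dw = ⟨a,(S^*S)⁻¹b⟩·∫_W e^{−½‖Sw‖²}dw` — the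
t-derivative at 0 of the sourced first moment, differentiated under the integral sign (the tree's
`B6Eq232GaussianMoment.integral_gauss_bilinear` at `M = S^*S`, `G = (S^*S)⁻¹`). [cite: BalabanImbrieJaffe1985, (4.1.1) p.309] -/
theorem integral_inner_mul_inner_mul_exp {S : W →ₗ[ℝ] F} (hS : Function.Injective S) (a b : W) :
    ∫ w : W, ⟪w, a⟫ * ⟪w, b⟫ * Real.exp (-(1 / 2) * ‖S w‖ ^ 2) =
      ⟪a, formInv S b⟫ * ∫ w : W, Real.exp (-(1 / 2) * ‖S w‖ ^ 2) := by
  have hint : Integrable (fun v : W => Real.exp (-(1 / 2) * ⟪v, formOp S v⟫)) := by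
    have h := partition_integrable hS
    refine h.congr (Filter.Eventually.of_forall fun v => ?_)
    simp only [inner_formOp_self']
  have h := Balaban1983to89.B6Eq232GaussianMoment.integral_gauss_bilinear (volume : Measure W) (formOp S) (formInv S)
    (formOp_symm' S) (formOp_comp_formInv hS) hint a b
  simp only [inner_formOp_self'] at h
  rw [real_inner_comm a (formInv S b)] at h
  rw [← h]
  refine integral_congr_ae (Filter.Eventually.of_forall fun v => ?_)
  simp only
  ring

end Gaussian

/-! ## §2  (4.1.1) ⇒ `G_{k,Ax}` is the second moment of `exp(−½‖∂A‖²)` on the constraint subspace -/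

section Propagator

variable {E F : Type*} [NormedAddCommGroup E] [InnerProductSpace ℝ E] [FiniteDimensional ℝ E]
  [MeasurableSpace E] [BorelSpace E]
  [NormedAddCommGroup F] [InnerProductSpace ℝ F] [FiniteDimensional ℝ F]

omit [FiniteDimensional ℝ E] [MeasurableSpace E] [BorelSpace E] [FiniteDimensional ℝ F] in
/-- No zero modes of `∂` on `V` ⇒ `∂ι_V` is injective. [folklore] -/
private theorem injective_S'' {V : Submodule ℝ E} {D : E →ₗ[ℝ] F} (hD : ∀ v : V, D (v : E) = 0 → v = 0) :
    Function.Injective (D ∘ₗ V.subtype) := by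
  intro v w h
  have : (D ∘ₗ V.subtype) (v - w) = 0 := by rw [map_sub, h, sub_self]
  exact sub_eq_zero.1 (hD _ this)

/-- **"The propagator G_{k,Ax} itself is the second moment of the measure exp(−½‖∂A‖²), restricted to the space of gauge fields
which satisfy the kth axial gauge condition and condition on the kth average fields vanishing"** — PROVED for the operator
formula `G_{k,Ax} = ι_V(ι_V^*∂^*∂ι_V)⁻¹ι_V^*` which satisfies (4.1.1) (p09's `axialPropagator V D`): for all sources `J, J′`,
`⟨J, G_{k,Ax}J′⟩ = Z_{k,Ax}^{−1}∫_V ⟨A,J⟩⟨A,J′⟩exp(−½‖∂A‖²)dA`, `V` the support of `δ(Q_kA)δ_{k,Ax}(A)`, `dA` its volume,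
`Z_{k,Ax} = ∫_V exp(−½‖∂A‖²)dA` ((4.1.1) at J = 0); no zero modes of `∂` on `V` (p. 309). [cite: BalabanImbrieJaffe1985, (4.1.1) p.309] -/
theorem inner_axialPropagator_eq_secondMoment {V : Submodule ℝ E} {D : E →ₗ[ℝ] F}
    (hD : ∀ v : V, D (v : E) = 0 → v = 0) (J J' : E) :
    ⟪J, axialPropagator V D J'⟫ =
      (Z V D)⁻¹ * ∫ v : V, ⟪(v : E), J⟫ * ⟪(v : E), J'⟫ * Real.exp (-(1 / 2) * ‖D (v : E)‖ ^ 2) := by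
  set S : V →ₗ[ℝ] F := D ∘ₗ V.subtype with hSdef
  have hS : Function.Injective S := injective_S'' hD
  have hZ : 0 < Z V D := (isAxialPropagator_axialPropagator V D hD).2
  have hL : ⟪J, axialPropagator V D J'⟫ =
      ⟪LinearMap.adjoint V.subtype J, formInv S (LinearMap.adjoint V.subtype J')⟫ := by
    unfold axialPropagator
    rw [LinearMap.comp_apply, LinearMap.comp_apply, ← LinearMap.adjoint_inner_left]
  have hI : ∫ v : V, ⟪(v : E), J⟫ * ⟪(v : E), J'⟫ * Real.exp (-(1 / 2) * ‖D (v : E)‖ ^ 2) =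
      ∫ v : V, ⟪v, LinearMap.adjoint V.subtype J⟫ * ⟪v, LinearMap.adjoint V.subtype J'⟫ *
        Real.exp (-(1 / 2) * ‖S v‖ ^ 2) := by
    refine integral_congr_ae (Filter.Eventually.of_forall fun v => ?_)
    simp only [hSdef, LinearMap.comp_apply, Submodule.subtype_apply, LinearMap.adjoint_inner_right]
  have hZ' : Z V D = ∫ v : V, Real.exp (-(1 / 2) * ‖S v‖ ^ 2) := rfl
  rw [hL, hI, integral_inner_mul_inner_mul_exp hS, ← hZ', mul_comm (⟪_, _⟫) (Z V D), ← mul_assoc,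
    inv_mul_cancel₀ hZ.ne', one_mul]

/-- The diagonal case: `⟨J, G_{k,Ax}J⟩ = Z_{k,Ax}^{−1}∫_V ⟨A,J⟩²exp(−½‖∂A‖²)dA` — the quadratic form that (4.1.1) exponentiates is
the second moment of the linear functional `⟨·, J⟩`. [cite: BalabanImbrieJaffe1985, (4.1.1) p.309] -/
theorem inner_self_axialPropagator_eq {V : Submodule ℝ E} {D : E →ₗ[ℝ] F}
    (hD : ∀ v : V, D (v : E) = 0 → v = 0) (J : E) :
    ⟪J, axialPropagator V D J⟫ = (Z V D)⁻¹ * ∫ v : V, ⟪(v : E), J⟫ ^ 2 * Real.exp (-(1 / 2) * ‖D (v : E)‖ ^ 2) := by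
  rw [inner_axialPropagator_eq_secondMoment hD]
  congr 1
  refine integral_congr_ae (Filter.Eventually.of_forall fun v => ?_)
  simp only [sq]

/-- Hence `⟨J, G_{k,Ax}J⟩ ≥ 0`: a second moment is nonnegative. [cite: BalabanImbrieJaffe1985, (4.1.1) p.309] -/
theorem inner_self_axialPropagator_nonneg {V : Submodule ℝ E} {D : E →ₗ[ℝ] F}
    (hD : ∀ v : V, D (v : E) = 0 → v = 0) (J : E) : 0 ≤ ⟪J, axialPropagator V D J⟫ := by
  rw [inner_self_axialPropagator_eq hD]
  have hZ : 0 < Z V D := (isAxialPropagator_axialPropagator V D hD).2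
  refine mul_nonneg (inv_nonneg.2 hZ.le) (integral_nonneg fun v => ?_)
  exact mul_nonneg (sq_nonneg _) (Real.exp_pos _).le

/-- **For ANY operator `G` satisfying the printed definition (4.1.1)** (p09's `IsAxialPropagator V D G`): its symmetric part is the
second moment, `½(⟨J, GJ′⟩ + ⟨J′, GJ⟩) = Z_{k,Ax}^{−1}∫_V ⟨A,J⟩⟨A,J′⟩exp(−½‖∂A‖²)dA` — (4.1.1) determines exactly the quadratic form
of `G` (polarization; no zero modes of `∂` on `V`). [cite: BalabanImbrieJaffe1985, (4.1.1) p.309] -/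
theorem secondMoment_of_isAxialPropagator {V : Submodule ℝ E} {D : E →ₗ[ℝ] F}
    (hD : ∀ v : V, D (v : E) = 0 → v = 0) {G : E →ₗ[ℝ] E} (hG : IsAxialPropagator V D G) (J J' : E) :
    (1 / 2) * (⟪J, G J'⟫ + ⟪J', G J⟫) =
      (Z V D)⁻¹ * ∫ v : V, ⟪(v : E), J⟫ * ⟪(v : E), J'⟫ * Real.exp (-(1 / 2) * ‖D (v : E)‖ ^ 2) := by
  set G₀ := axialPropagator V D with hG₀
  have hq : ∀ X : E, ⟪X, G X⟫ = ⟪X, G₀ X⟫ := fun X =>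
    quadForm_eq_of_isAxialPropagator hG (isAxialPropagator_axialPropagator V D hD).1 X
  have hpol : ∀ (T : E →ₗ[ℝ] E), ⟪J, T J'⟫ + ⟪J', T J⟫ = ⟪J + J', T (J + J')⟫ - ⟪J, T J⟫ - ⟪J', T J'⟫ := by
    intro T
    rw [map_add, inner_add_left, inner_add_right, inner_add_right]
    ring
  have hsym : ⟪J', G₀ J⟫ = ⟪J, G₀ J'⟫ := by
    rw [hG₀, ← axialPropagator_symm hD J J', real_inner_comm]
  rw [hpol G, hq, hq, hq, ← hpol G₀, hsym, ← inner_axialPropagator_eq_secondMoment hD J J']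
  ring

end Propagator

/-! ## §3  (4.3.3) ⇒ `C^{(k)}` is the second moment of `exp(−½⟨B, Δ_kB⟩)` on `δ(QB)δ_{Ax}(B)` -/

section UnitPropagator

variable {E F E₁ : Type*} [NormedAddCommGroup E] [InnerProductSpace ℝ E] [FiniteDimensional ℝ E]
  [NormedAddCommGroup F] [InnerProductSpace ℝ F] [FiniteDimensional ℝ F]
  [NormedAddCommGroup E₁] [InnerProductSpace ℝ E₁] [FiniteDimensional ℝ E₁] [MeasurableSpace E₁] [BorelSpace E₁]

/-- **`C^{(k)}` of (4.3.3) is the second moment of `exp(−½⟨B, Δ_kB⟩)` restricted to `δ(QB)δ_{Ax}(B)`**: for p09 g2's operator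
formula `unitPropagator V D Qs W` (= the (4.1.1)-type second moment of `exp(−½‖∂H_{k,Ax}B‖²)`, `⟨B, Δ_kB⟩ = ‖∂H_{k,Ax}B‖²`) and
all unit-lattice sources `J, J′`: `⟨J, C^{(k)}J′⟩ = (Z^{(k)})^{−1}∫_W ⟨B,J⟩⟨B,J′⟩exp(−½⟨B, Δ_kB⟩)dB`, `W` the support of
`δ(QB)δ_{Ax}(B)`; no zero modes of `∂H_{k,Ax}` on `W`. [cite: BalabanImbrieJaffe1985, (4.3.3) p.311] -/
theorem inner_unitPropagator_eq_secondMoment (V : Submodule ℝ E) (D : E →ₗ[ℝ] F) (Qs : E₁ →ₗ[ℝ] E) (W : Submodule ℝ E₁)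
    (hT : ∀ w : W, D (Hop V D Qs (w : E₁)) = 0 → w = 0) (J J' : E₁) :
    ⟪J, unitPropagator V D Qs W J'⟫ =
      (unitZ W (deltaOp V D Qs))⁻¹ *
        ∫ w : W, ⟪(w : E₁), J⟫ * ⟪(w : E₁), J'⟫ * Real.exp (-(1 / 2) * ⟪(w : E₁), deltaOp V D Qs (w : E₁)⟫) := by
  have hΔ : ∀ B : E₁, ⟪B, deltaOp V D Qs B⟫ = ‖(D ∘ₗ Hop V D Qs) B‖ ^ 2 := fun B => inner_deltaOp V D Qs B
  have hT' : ∀ w : W, (D ∘ₗ Hop V D Qs) (w : E₁) = 0 → w = 0 := fun w hw => hT w hw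
  unfold unitPropagator
  rw [inner_axialPropagator_eq_secondMoment hT', unitZ_eq_Z hΔ]
  congr 1
  refine integral_congr_ae (Filter.Eventually.of_forall fun w => ?_)
  simp only [hΔ]

end UnitPropagator

/-! ## §4  On the tori of the series: `G_{k,Ax}` as the second moment, unconditionally in the standing range -/

section Torus

open Literature.MathematicalPhysics.QuantumFieldTheory.Balaban1983to89
open LatticeFieldCalculus

variable {P : Params}

/-- Components are unchanged by p09's identification `toE`. [folklore] -/
@[simp] private theorem toE_apply' (A : VecField P 0 ℝ) (b : PBond P 0) : toE P A b = A b := rfl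

/-- `⟨toE A, toE B⟩ = Σ_b A_b B_b`. [folklore] -/
private theorem inner_toE' (A B : VecField P 0 ℝ) : ⟪toE P A, toE P B⟫ = ∑ b : PBond P 0, A b * B b := by
  simp [PiLp.inner_apply, mul_comm]

/-- **"G_{k,Ax} is the second moment" ON THE TORUS, unconditionally**: for the η-bond fields of the series' lattice calculus with the
pairing `⟨A, J⟩ = Σ_b η^dA_bJ_b` (`bondPairing w`, `w = η^d > 0`) and `½‖∂A‖² = curlAction w c A` (`c ≠ 0`), p09's torus propagator
(4.1.1) satisfies, for every `k ≤ m + K` and all sources `J, J′`: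
`⟨J, G_{k,Ax}J′⟩ = Z_{k,Ax}^{−1}∫_{Q_kA = 0, δ_{k,Ax}(A)} ⟨A,J⟩⟨A,J′⟩exp(−½‖∂A‖²)dA` — the no-zero-modes claim of p. 309 being the
theorem `BIJ85NoZeroModes309Torus.noZeroModes_V411_holds`. [cite: BalabanImbrieJaffe1985, (4.1.1) p.309] -/
theorem bondPairing_torusPropagator_eq_secondMoment {k : ℕ} (hk : k ≤ P.m + P.K) {w : ℝ} (hw : 0 < w) {c : ℝ}
    (hc : c ≠ 0) (J J' : VecField P 0 ℝ) :
    bondPairing w J (torusPropagator w c k J') =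
      (Z (V411 P k) (curlOp (P := P) w c))⁻¹ *
        ∫ v : V411 P k,
          bondPairing w ((toE P).symm (v : BondSpace P)) J * bondPairing w ((toE P).symm (v : BondSpace P)) J' *
            Real.exp (-curlAction w c ((toE P).symm (v : BondSpace P))) := by
  have hD := BIJ85NoZeroModes309Torus.noZeroModes_V411_holds (P := P) hk hw hc
  -- the left member as a matrix element of p09's `axialPropagator` on `BondSpace P`
  set X : VecField P 0 ℝ := (toE P).symm (axialPropagator (V411 P k) (curlOp (P := P) w c) (toE P J')) with hX
  have hG : torusPropagator w c k J' = w • X := by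
    simp only [torusPropagator, hX, LinearMap.smul_apply, LinearMap.comp_apply, LinearEquiv.coe_toLinearMap]
  have hGE : axialPropagator (V411 P k) (curlOp (P := P) w c) (toE P (w • J')) = toE P (w • X) := by
    rw [map_smul, map_smul, map_smul, hX, LinearEquiv.apply_symm_apply]
  have hlhs : ⟪toE P (w • J), axialPropagator (V411 P k) (curlOp (P := P) w c) (toE P (w • J'))⟫ =
      bondPairing w J (torusPropagator w c k J') := by
    rw [hGE, hG, inner_toE']
    unfold bondPairing
    refine Finset.sum_congr rfl fun b _ => ?_
    simp only [Pi.smul_apply, smul_eq_mul]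
    ring
  rw [← hlhs, inner_axialPropagator_eq_secondMoment hD]
  congr 1
  refine integral_congr_ae (Filter.Eventually.of_forall fun v => ?_)
  have h1 : -(1 / 2) * ‖curlOp (P := P) w c (v : BondSpace P)‖ ^ 2 = -curlAction w c ((toE P).symm (v : BondSpace P)) := by
    rw [neg_mul, half_norm_curlOp_sq hw.le]
  have h2 : ⟪((v : BondSpace P)), toE P (w • J)⟫ = bondPairing w ((toE P).symm (v : BondSpace P)) J := by
    rw [← inner_toE_smul w, LinearEquiv.apply_symm_apply]
  have h3 : ⟪((v : BondSpace P)), toE P (w • J')⟫ = bondPairing w ((toE P).symm (v : BondSpace P)) J' := by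
    rw [← inner_toE_smul w, LinearEquiv.apply_symm_apply]
  simp only [h1, h2, h3]

/-- The diagonal case on the torus: `⟨J, G_{k,Ax}J⟩ = Z_{k,Ax}^{−1}∫ ⟨A,J⟩²exp(−½‖∂A‖²)dA ≥ 0` (standing range, `w > 0`, `c ≠ 0`).
[cite: BalabanImbrieJaffe1985, (4.1.1) p.309] -/
theorem bondPairing_torusPropagator_self_nonneg {k : ℕ} (hk : k ≤ P.m + P.K) {w : ℝ} (hw : 0 < w) {c : ℝ}
    (hc : c ≠ 0) (J : VecField P 0 ℝ) : 0 ≤ bondPairing w J (torusPropagator w c k J) := by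
  rw [bondPairing_torusPropagator_eq_secondMoment hk hw hc]
  have hZ : 0 < Z (V411 P k) (curlOp (P := P) w c) := BIJ85NoZeroModes309Torus.Z_torus_pos hk hw hc
  refine mul_nonneg (inv_nonneg.2 hZ.le) (integral_nonneg fun v => ?_)
  exact mul_nonneg (mul_self_nonneg _) (Real.exp_pos _).le

end Torus

end

end Literature.MathematicalPhysics.QuantumFieldTheory.BalabanImbrieJaffe1984to88.BIJ85SecondMoment411
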